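import Literature.Geometry.Lorentzian.CarterThresholdKernelBound
import Literature.Geometry.Lorentzian.CarterThresholdBarrierGeometry
import Literature.Geometry.Lorentzian.CarterFarBarrierEnvelope
import HarnessLib

/-!
# The threshold-regime Green-kernel bound for Carter's equation in Breitenlohner–Freedman stable
# sectors, with a uniform explicit constant (tortoise variable)
(namespace `Literature.Geometry.Lorentzian.Kerr`.)

Carter's radial equation `u″ + φu = 0`, `φ = ω² − V∘ρ` (`V = Kerr.sepPotential M a ω m Λ`, `ρ` a
tortoise radius; DRSR arXiv:1402.7034 §5.2.3) AT THE SUPERRADIANT THRESHOLD `ω = mω₊ ≠ 0` of a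
sub-extremal Kerr exterior in a Breitenlohner–Freedman stable sector with margin
`(1 + θ₁)(2r₊ω)² ≤ Λ′` (`0 < θ₁ ≤ 1`), near extremality (`r₊ − r₋ ≤ θ₁M/4`, collar `θ(r₊ − r₋) ≤ θ₁M/4`),
for `Λ′ ≥ 2.5·10¹⁰/θ₁³` and GIVEN the census. For the horizon-data solution `u_𝓗` (`‖u_𝓗‖ → 1` at
`−∞`, flux `0`) and the infinity-data solution `u_𝓘` (`‖u_𝓘‖ → 1`, `‖u_𝓘′‖ → |ω|` at `+∞`, flux `ω`):

* `thresholdRegime_kernel_le` — for all `x ≤ x′` with `ρ x′ ≥ r₊ + θ(r₊ − r₋)`,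
  `‖u_𝓗 x‖·‖u_𝓘 x′‖ ≤ K·‖u_𝓗 u_𝓘′ − u_𝓘 u_𝓗′‖(x)` with the UNIFORM explicit constant
  `K = (25/7)(8A₀/(θ₁M) + √A₀) + ((P_I + 829440·P_I′/(θ₁²ω²M))e)²/|ω| + √A₀/2`,
  `A₀ = 96R²/(θ₁Δ(r₊ + θ(r₊ − r₋))ω²) + 12R²/θ₁²`, `R = max(7M, √(12Λ)/|ω|, 1/(Mω²))`, and `P_I`, `P_I′`
  the κ-free far-envelope constants of `CarterFarBarrierEnvelope` (`ζ = θ₁M/2`, `η = θ₁/(100M)`,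
  `Φ = ω² + 6Λ/M²`), PROVIDED the uniform depth condition
  `8((P_I·ω²R/3 + P_I′)e)² ≤ ω²(θ₁/3)³/32 · sinh(2·(θ₁/3)⁴√Λ′/256)` (an `exp(c√Λ′) ≥ poly(Λ)` condition,
  discharged by `Λ ≥ Λ₀` in the bookkeeping).

Assembly of `threshold_barrier_geometry` (points, floors, layer, monomial facts),
`carter_envelope_I(_deriv)_of_far_start` (far envelope restarted at the κ-free end of the barrier) and
`threshold_kernel_le_of_barrier` (the one-barrier mechanism); the only work here is to replace the
`b₂`-dependent constants by uniform ones (`δ ≥ θ₁M/2`, `θ₁ρ b₂ ≤ 3δ`, `ρ b₂ ≤ R`, `Λ′ ≤ 4ω²(ρ b₂)²`).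
Every atom of `K` is a monomial in `Λ, κ⁻¹, |ω|^{±1}, M^{±1}, θ^{-1}, θ₁^{-1}` (bookkeeping elsewhere).

## References
* M. Dafermos, I. Rodnianski, Y. Shlapentokh-Rothman, arXiv:1402.7034 = Ann. of Math. 183 (2016),
  §§5.2.3, 6.3–6.4, 8 (key `DafermosRodnianskiShlapentokhrothman2014`).
* R. Teixeira da Costa, Commun. Math. Phys. 378 (2020), Prop. 2.20 (key `Costa2019`). Folklore assembly.
-/

noncomputable section

open Filter Set Literature.Analysis.ODE
open scoped _root_.Topology _root_.ComplexConjugate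

namespace Literature.Geometry.Lorentzian

namespace Kerr

section ThresholdRegime

variable {M a ω Λ : ℝ} {m : ℤ} {ρ : ℝ → ℝ} {uH uH₁ uI uI₁ : ℝ → ℂ}

/-- `1/min(p, q) ≤ 1/p + 1/q` for `p, q > 0`. [folklore] -/
private theorem one_div_min_le {p q : ℝ} (hp : 0 < p) (hq : 0 < q) : 1 / min p q ≤ 1 / p + 1 / q := by
  rcases le_total p q with h | h
  · rw [min_eq_left h]; have : 0 ≤ 1 / q := by positivity
    linarith
  · rw [min_eq_right h]; have : 0 ≤ 1 / p := by positivity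
    linarith

set_option maxHeartbeats 400000 in
-- one long assembly of three landed theorems plus uniformisation of the constants
/-- **The threshold-regime kernel bound with a uniform explicit constant.** See the module docstring
for the setting; hypotheses: tortoise radius, sub-extremal parameters, admissible triple with `Λ ≥ 1`,
threshold `ω = mω₊ ≠ 0`, margin `θ₁ ∈ (0, 1]`, `r₊ − r₋ ≤ θ₁M/4`, collar `θ > 0` with
`θ(r₊ − r₋) ≤ θ₁M/4`, `Λ′ ≥ 2.5·10¹⁰/θ₁³`, the census, the two solutions with horizon/infinity data, and
the uniform depth condition. Conclusion: the two-point bound for all `x ≤ x′` with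
`r₊ + θ(r₊ − r₋) ≤ ρ x′`. [folklore] -/
theorem thresholdRegime_kernel_le (hρ : IsTortoiseRadius M a ρ) (hMa : IsSubextremal M a)
    (hadm : IsAdmissibleTriple a ω m Λ) (hΛ : 1 ≤ Λ) (hωth : ω = m * horizonAngularVelocity M a)
    (hω : ω ≠ 0) {θ₁ : ℝ} (hθ₁ : 0 < θ₁) (hθ₁1 : θ₁ ≤ 1)
    (hBF : (1 + θ₁) * (2 * rPlus M a * ω) ^ 2 ≤ Λ - 2 * a * m * ω)
    (hd : rPlus M a - rMinus M a ≤ θ₁ * M / 4)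
    {θ : ℝ} (hθ : 0 < θ) (hθd : θ * (rPlus M a - rMinus M a) ≤ θ₁ * M / 4)
    (hΛ' : 2.5e10 / θ₁ ^ 3 ≤ Λ - 2 * a * m * ω)
    (hord : (Ioi (rPlus M a) ∩ {r : ℝ | ω ^ 2 ≤ sepPotential M a ω m Λ r}).OrdConnected)
    (hu : ∀ x, HasDerivAt uH (uH₁ x) x ∧
      HasDerivAt uH₁ (-(((ω ^ 2 - sepPotential M a ω m Λ (ρ x) : ℝ) : ℂ) * uH x)) x)
    (hv : ∀ x, HasDerivAt uI (uI₁ x) x ∧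
      HasDerivAt uI₁ (-(((ω ^ 2 - sepPotential M a ω m Λ (ρ x) : ℝ) : ℂ) * uI x)) x)
    (hH0 : Tendsto (fun x ↦ ‖uH x‖) atBot (𝓝 1))
    (hHf : ∀ x, (starRingEnd ℂ (uH x) * uH₁ x).im = -(ω - m * horizonAngularVelocity M a))
    (hI0 : Tendsto (fun x ↦ ‖uI x‖) atTop (𝓝 1))
    (hI1 : Tendsto (fun x ↦ ‖uI₁ x‖) atTop (𝓝 |ω|))
    (hIf : ∀ x, (starRingEnd ℂ (uI x) * uI₁ x).im = ω)
    {R η Φ B PI PI' A₀ : ℝ}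
    (hRdef : R = max (7 * M) (max (Real.sqrt (12 * Λ) / |ω|) (1 / (M * ω ^ 2))))
    (hηdef : η = θ₁ / (100 * M)) (hΦdef : Φ = ω ^ 2 + 6 * Λ / M ^ 2)
    (hBdef : B = (Φ / η ^ 2) ^ 16 * Real.exp (2 * η * (50 * M ^ 2 / (θ₁ * M / 2))) *
      (η ^ 2 * (2 + 2 * |ω| * R) ^ 2 + 2 * ω ^ 2))
    (hPIdef : PI = Real.sqrt ((2 + 2 * |ω| * R) ^ 2 + B / η ^ 2))
    (hPI'def : PI' = Real.sqrt (2 * ω ^ 2 + B))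
    (hA₀def : A₀ = 96 * R ^ 2 /
        (θ₁ * delta M a (rPlus M a + θ * (rPlus M a - rMinus M a)) * ω ^ 2) + 12 * R ^ 2 / θ₁ ^ 2)
    (hdepth : 8 * ((PI * (ω ^ 2 * R / 3) + PI') * Real.exp 1) ^ 2 ≤
      ω ^ 2 * (θ₁ / 3) ^ 3 / 32 *
        Real.sinh (2 * ((θ₁ / 3) ^ 4 * Real.sqrt (Λ - 2 * a * m * ω) / 256)))
    {x x' : ℝ} (hxx' : x ≤ x') (hx' : rPlus M a + θ * (rPlus M a - rMinus M a) ≤ ρ x') :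
    ‖uH x‖ * ‖uI x'‖ ≤
      (25 / 7 * (8 * A₀ / (θ₁ * M) + Real.sqrt A₀) +
          ((PI + 829440 / (θ₁ ^ 2 * ω ^ 2 * M) * PI') * Real.exp 1) ^ 2 / |ω| + Real.sqrt A₀ / 2) *
        ‖uH x * uI₁ x - uI x * uH₁ x‖ := by
  have ha : |a| < M := hMa
  have hM : 0 < M := hMa.pos
  have hrp : 0 < rPlus M a := rPlus_pos hM a
  have hMr : M ≤ rPlus M a := M_le_rPlus M a
  have hrm : rMinus M a < rPlus M a := hMa.rMinus_lt_rPlus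
  have hω0 : 0 < |ω| := abs_pos.2 hω
  have hω2 : 0 < ω ^ 2 := by positivity
  have hσ : ω - m * horizonAngularVelocity M a = 0 := by rw [hωth]; ring
  -- the geometry of the barrier
  obtain ⟨b₂, sθ, slo, smid, L, KL, k₀, k₁, hF, hφb₂, hb₂R, hrb_lo, hsθ, hθlo, hlomid, hmidβ, hL, hk₀,
    hfl₀, hk₁, hfl₁, hKL0, hflL, hKLL, hℓ, hk₁sq, hk₀sq, hL1, hL2, hΛ4⟩ :=
    threshold_barrier_geometry hρ hMa hadm hωth hω hθ₁ hθ₁1 hBF hd hθ hθd hΛ' hord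
  rw [← hRdef] at hb₂R
  set rb := ρ b₂ with hrbdef
  set δ := rb - rPlus M a with hδdef
  set d := rPlus M a - rMinus M a with hddef
  have hd0 : 0 < d := sub_pos.2 hrm
  have hδM : θ₁ * M / 2 ≤ δ := by
    have e : (1 + θ₁ / 2) * rPlus M a = rPlus M a + θ₁ * rPlus M a / 2 := by ring
    have h1 : θ₁ * M ≤ θ₁ * rPlus M a := mul_le_mul_of_nonneg_left hMr hθ₁.le
    rw [hδdef]; linarith only [hrb_lo, e, h1]
  have hδ : 0 < δ := lt_of_lt_of_le (by positivity) hδM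
  have hrbM : M ≤ rb := by linarith only [hδ, hδdef, hMr]
  have hrb0 : 0 < rb := hM.trans_le hrbM
  have hrbR : rb ≤ R := hb₂R.le
  have hR0 : 0 < R := hrb0.trans_le hrbR
  have hδrb : δ ≤ rb := by linarith only [hδdef, hrp]
  have hδθ : θ₁ * rb ≤ 3 * δ := by
    have e : θ₁ * rb = θ₁ * rPlus M a + θ₁ * δ := by rw [hδdef]; ring
    have h1 : θ₁ * δ ≤ δ := mul_le_of_le_one_left hδ.le hθ₁1
    have h2 : θ₁ * M ≤ θ₁ * rPlus M a := mul_le_mul_of_nonneg_left hMr hθ₁.le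
    have e2 : (1 + θ₁ / 2) * rPlus M a = rPlus M a + θ₁ * rPlus M a / 2 := by ring
    linarith only [e, h1, hrb_lo, e2, hδdef]
  -- the far envelope of `u_𝓘` restarted at `b₂` (`ζ = θ₁M/2`)
  have h7p : rPlus M a < 7 * M := by linarith only [rPlus_le_two_mul_self hM.le a, hM]
  obtain ⟨x₇, hx₇⟩ := hρ.exists_apply_eq h7p
  have hζ : 0 < θ₁ * M / 2 := by positivity
  have hZ : rPlus M a + θ₁ * M / 2 ≤ ρ b₂ := by rw [← hrbdef]; linarith only [hδM, hδdef]
  have hη : 0 < η := by rw [hηdef]; positivity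
  have hΦη : η ^ 2 ≤ Φ := by
    rw [hηdef, hΦdef]
    have h1 : (θ₁ / (100 * M)) ^ 2 ≤ 6 * Λ / M ^ 2 := by
      rw [div_pow, div_le_div_iff₀ (by positivity) (by positivity)]
      have hθ2 : θ₁ ^ 2 ≤ 1 := pow_le_one₀ hθ₁.le hθ₁1
      have hM2 : 0 ≤ M ^ 2 := sq_nonneg M
      have h2 : θ₁ ^ 2 * M ^ 2 ≤ 1 * M ^ 2 := mul_le_mul_of_nonneg_right hθ2 hM2
      have h3 : 1 * M ^ 2 ≤ 6 * Λ * (100 * M) ^ 2 := by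
        have e : 6 * Λ * (100 * M) ^ 2 = 60000 * Λ * M ^ 2 := by ring
        rw [e]; nlinarith only [hΛ, hM2]
      exact h2.trans h3
    linarith only [h1, hω2]
  have hΦall : ∀ s, ω ^ 2 - sepPotential M a ω m Λ (ρ s) ≤ Φ := fun s ↦ by
    rw [hΦdef]; exact coeff_le_of_admissible hM ha.le hadm hΛ (hρ.rPlus_lt s).le
  have hposI : ∀ s, b₂ ≤ s → 0 ≤ ω ^ 2 - sepPotential M a ω m Λ (ρ s) := by
    intro s hs
    rcases hs.eq_or_lt with h | h
    · rw [← h, hφb₂]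
    · by_contra hcon
      push Not at hcon
      have : s ∈ {s | ω ^ 2 - sepPotential M a ω m Λ (ρ s) ≤ 0} := hcon.le
      rw [hF] at this
      exact absurd this (not_le.2 h)
  have hPI : ∀ s, b₂ ≤ s → ‖uI s‖ ≤ PI := by
    intro s hs
    have h := carter_envelope_I_of_far_start hρ hMa hadm hω hv hI0 hI1 hx₇ hζ hZ hη hΦη hΦall hposI hs
    rw [← hRdef, ← hBdef] at h
    rw [hPIdef]
    exact Real.le_sqrt_of_sq_le h
  have hPI' : ‖uI₁ b₂‖ ≤ PI' := by
    have h := carter_envelope_I_deriv_of_far_start hρ hMa hadm hω hv hI0 hI1 hx₇ hζ hZ hη hΦη hΦall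
      hposI le_rfl
    rw [hPI'def]
    rw [← hRdef, ← hBdef] at h
    exact Real.le_sqrt_of_sq_le h
  have hPI0 : 0 ≤ PI := by rw [hPIdef]; exact Real.sqrt_nonneg _
  have hPI'0 : 0 ≤ PI' := by rw [hPI'def]; exact Real.sqrt_nonneg _
  -- `1/L ≤ ω²R/3` and `L ≤ 829440/(θ₁²ω²M)`
  have hLinv : PI / L ≤ PI * (ω ^ 2 * R / 3) := by
    rw [div_eq_mul_one_div]
    refine mul_le_mul_of_nonneg_left ?_ hPI0
    have h1 : 1 / L ≤ ω ^ 2 * δ ^ 2 / (3 * rb) := by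
      rw [one_div_le (hL) (by positivity), one_div_div]; exact hL1
    have h2 : ω ^ 2 * δ ^ 2 / (3 * rb) ≤ ω ^ 2 * R / 3 := by
      rw [div_le_div_iff₀ (by positivity) (by norm_num)]
      have : δ ^ 2 ≤ rb * R := by nlinarith only [hδrb, hrbR, hδ]
      nlinarith only [this, hω2]
    exact h1.trans h2
  have hLup : L ≤ 829440 / (θ₁ ^ 2 * ω ^ 2 * M) := by
    refine hL2.trans ?_
    rw [div_le_div_iff₀ (by positivity) (by positivity)]
    -- `92160 r_b θ₁² ω² M ≤ 829440 ω² δ²`: `θ₁² r_b² ≤ 9δ²`, `M ≤ r_b`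
    have h1 : (θ₁ * rb) ^ 2 ≤ (3 * δ) ^ 2 := pow_le_pow_left₀ (by positivity) hδθ 2
    have h2 : θ₁ ^ 2 * rb * M ≤ 9 * δ ^ 2 := by nlinarith only [h1, hrbM, hM, hθ₁]
    nlinarith only [h2, hω2]
  -- the depth in the form needed by the one-barrier bound
  have hdeep : 8 * ((PI / L + PI') * Real.exp 1) ^ 2 ≤
      k₁ * |ω| * Real.sinh (2 * (k₁ * (smid - slo))) := by
    -- left side
    have he : 0 < Real.exp 1 := Real.exp_pos 1
    have hl : 8 * ((PI / L + PI') * Real.exp 1) ^ 2 ≤ 8 * ((PI * (ω ^ 2 * R / 3) + PI') * Real.exp 1) ^ 2 := by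
      have h1 : (PI / L + PI') * Real.exp 1 ≤ (PI * (ω ^ 2 * R / 3) + PI') * Real.exp 1 :=
        mul_le_mul_of_nonneg_right (by linarith only [hLinv]) he.le
      have h0 : 0 ≤ (PI / L + PI') * Real.exp 1 := by positivity
      nlinarith only [h1, h0]
    -- right side: `k₁ ≥ |ω|(θ₁/3)³/32`, `2k₁ℓ ≥ 2·(θ₁/3)⁴√Λ′/256`
    set k₁m := |ω| * (θ₁ / 3) ^ 3 / 32 with hk₁m
    have hk₁m0 : 0 ≤ k₁m := by positivity
    have hθ3 : 0 < θ₁ / 3 := by positivity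
    have hθ31 : θ₁ / 3 ≤ 1 := by linarith only [hθ₁1]
    have hkk : k₁m ≤ k₁ := by
      have h1 : k₁m ^ 2 ≤ k₁ ^ 2 := by
        refine le_trans ?_ hk₁sq
        have h2 : (θ₁ / 3) ^ 5 ≤ δ ^ 5 / rb ^ 5 := by
          rw [← div_pow]; exact pow_le_pow_left₀ hθ3.le (by rw [le_div_iff₀ hrb0]; linarith only [hδθ]) 5
        have h3 : (θ₁ / 3) ^ 6 ≤ (θ₁ / 3) ^ 5 := pow_le_pow_of_le_one hθ3.le hθ31 (by norm_num)
        calc k₁m ^ 2 = ω ^ 2 * (θ₁ / 3) ^ 6 / 1024 := by rw [hk₁m, div_pow, mul_pow, sq_abs]; ring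
          _ ≤ ω ^ 2 * (δ ^ 5 / rb ^ 5) / 1024 := by gcongr; exact h3.trans h2
          _ = ω ^ 2 * δ ^ 5 / (1024 * rb ^ 5) := by field_simp
      exact (pow_le_pow_iff_left₀ hk₁m0 hk₁.le two_ne_zero).1 h1
    have hz : 2 * ((θ₁ / 3) ^ 4 * Real.sqrt (Λ - 2 * a * m * ω) / 256) ≤ 2 * (k₁ * (smid - slo)) := by
      refine mul_le_mul_of_nonneg_left ?_ (by norm_num)
      -- `√Λ′ ≤ 2|ω| r_b`, `θ₁ r_b ≤ 3δ`, `ℓ ≥ δ/4`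
      have hΛ'0 : 0 ≤ Λ - 2 * a * m * ω := le_trans (by positivity) hΛ'
      have h1 : Real.sqrt (Λ - 2 * a * m * ω) ≤ 2 * |ω| * rb := by
        rw [Real.sqrt_le_left (by positivity)]
        calc Λ - 2 * a * m * ω ≤ 4 * ω ^ 2 * rb ^ 2 := hΛ4
          _ = (2 * |ω| * rb) ^ 2 := by rw [mul_pow, mul_pow, sq_abs]; ring
      have h2 : (θ₁ / 3) ^ 4 * Real.sqrt (Λ - 2 * a * m * ω) / 256 ≤
          (θ₁ / 3) ^ 3 / 32 * (2 * |ω| * rb) * (θ₁ / 3) / 8 := by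
        have := mul_le_mul_of_nonneg_left h1 (show 0 ≤ (θ₁ / 3) ^ 4 by positivity)
        have e : (θ₁ / 3) ^ 3 / 32 * (2 * |ω| * rb) * (θ₁ / 3) / 8 = (θ₁ / 3) ^ 4 * (2 * |ω| * rb) / 256 := by
          ring
        rw [e]; linarith only [this]
      have h3 : (θ₁ / 3) ^ 3 / 32 * (2 * |ω| * rb) * (θ₁ / 3) / 8 ≤ k₁m * (δ / 4) := by
        rw [hk₁m]
        have : |ω| * rb * (θ₁ / 3) ≤ |ω| * δ := by nlinarith only [hδθ, hω0]
        nlinarith only [this, pow_pos hθ3 3]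
      have h4 : k₁m * (δ / 4) ≤ k₁ * (smid - slo) := mul_le_mul hkk hℓ (by positivity) hk₁.le
      linarith only [h2, h3, h4]
    have hsinh := Real.sinh_le_sinh.2 hz
    have hsinh0 : 0 ≤ Real.sinh (2 * ((θ₁ / 3) ^ 4 * Real.sqrt (Λ - 2 * a * m * ω) / 256)) :=
      Real.sinh_nonneg_iff.2 (by positivity)
    have hr : ω ^ 2 * (θ₁ / 3) ^ 3 / 32 * Real.sinh (2 * ((θ₁ / 3) ^ 4 * Real.sqrt (Λ - 2 * a * m * ω) / 256))
        ≤ k₁ * |ω| * Real.sinh (2 * (k₁ * (smid - slo))) := by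
      have e : ω ^ 2 * (θ₁ / 3) ^ 3 / 32 = k₁m * |ω| := by rw [hk₁m, ← sq_abs]; ring
      rw [e]
      exact mul_le_mul (mul_le_mul_of_nonneg_right hkk hω0.le) hsinh hsinh0 (by positivity)
    exact hl.trans (hdepth.trans hr)
  -- the one-barrier bound
  have hx'' : sθ ≤ x' := by rw [← hρ.le_iff_le hMa, hsθ]; exact hx'
  have key := threshold_kernel_le_of_barrier hρ hMa hσ hω hu hv hH0 hHf hIf hF hθlo hlomid hmidβ hL hk₀
    hfl₀ hk₁ hfl₁ hKL0 hflL hKLL hPI hPI' hdeep hxx' hx''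
  -- uniformisation of the constant
  have hW0 : 0 ≤ ‖uH x * uI₁ x - uI x * uH₁ x‖ := norm_nonneg _
  refine key.trans (mul_le_mul_of_nonneg_right ?_ hW0)
  set ℓ := smid - slo with hℓdef
  have hℓ0 : 0 < ℓ := lt_of_lt_of_le (by positivity) hℓ
  -- `1/k₀² ≤ A₀`
  have hΔθ : 0 < delta M a (rPlus M a + θ * d) :=
    delta_pos ha.le (lt_add_of_pos_right _ (mul_pos hθ hd0))
  have hA₀ : 1 / k₀ ^ 2 ≤ A₀ := by
    have hp : 0 < delta M a (rPlus M a + θ * d) * (ω ^ 2 * δ / (32 * rb ^ 3)) := by positivity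
    have hq : 0 < 3 * δ ^ 2 / (4 * rb ^ 4) := by positivity
    have h1 : 1 / k₀ ^ 2 ≤ 1 / min (delta M a (rPlus M a + θ * d) * (ω ^ 2 * δ / (32 * rb ^ 3)))
        (3 * δ ^ 2 / (4 * rb ^ 4)) := one_div_le_one_div_of_le (lt_min hp hq) hk₀sq
    refine h1.trans ((one_div_min_le hp hq).trans ?_)
    rw [hA₀def]
    have hrb2 : rb ^ 2 ≤ R ^ 2 := pow_le_pow_left₀ hrb0.le hrbR 2
    refine add_le_add ?_ ?_
    · -- `32 r_b³/(Δθ ω² δ) ≤ 96 R²/(θ₁ Δθ ω²)` iff `32 r_b³ θ₁ ≤ 96 R² δ`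
      have h3 : θ₁ * rb ^ 3 ≤ 3 * δ * R ^ 2 := by nlinarith only [hδθ, hrb2, hrb0, hδ]
      have h4 := mul_le_mul_of_nonneg_left h3
        (show 0 ≤ delta M a (rPlus M a + θ * d) * ω ^ 2 by positivity)
      have e1 : 1 / (delta M a (rPlus M a + θ * d) * (ω ^ 2 * δ / (32 * rb ^ 3))) =
          32 * rb ^ 3 / (delta M a (rPlus M a + θ * d) * ω ^ 2 * δ) := by
        rw [one_div, ← mul_div_assoc, inv_div, mul_assoc]
      rw [e1, div_le_div_iff₀ (by positivity) (by positivity)]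
      nlinarith only [h4]
    · rw [one_div_le hq (by positivity), one_div_div, div_le_div_iff₀ (by positivity) (by positivity)]
      have h1 : (θ₁ * rb) ^ 2 ≤ (3 * δ) ^ 2 := pow_le_pow_left₀ (by positivity) hδθ 2
      nlinarith only [h1, hrb2, sq_nonneg θ₁, sq_nonneg δ, hθ₁, hδ]
  have hA₀0 : 0 ≤ A₀ := le_trans (by positivity) hA₀
  have hk₀inv : 1 / k₀ ≤ Real.sqrt A₀ := by
    rw [Real.le_sqrt (by positivity) hA₀0, div_pow, one_pow]; exact hA₀
  -- first summand
  have h1 : 25 / 7 * ((1 + k₀ * ℓ) / (k₀ ^ 2 * ℓ)) ≤ 25 / 7 * (8 * A₀ / (θ₁ * M) + Real.sqrt A₀) := by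
    refine mul_le_mul_of_nonneg_left ?_ (by norm_num)
    have e : (1 + k₀ * ℓ) / (k₀ ^ 2 * ℓ) = 1 / k₀ ^ 2 * (1 / ℓ) + 1 / k₀ := by field_simp
    rw [e]
    refine add_le_add ?_ hk₀inv
    have h2 : 1 / ℓ ≤ 8 / (θ₁ * M) := by
      rw [div_le_div_iff₀ hℓ0 (by positivity)]; nlinarith only [hℓ, hδM]
    calc 1 / k₀ ^ 2 * (1 / ℓ) ≤ A₀ * (8 / (θ₁ * M)) :=
          mul_le_mul hA₀ h2 (by positivity) hA₀0
      _ = 8 * A₀ / (θ₁ * M) := by ring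
  -- second summand
  have h2 : ((PI + L * PI') * Real.exp 1) ^ 2 / |ω| ≤
      ((PI + 829440 / (θ₁ ^ 2 * ω ^ 2 * M) * PI') * Real.exp 1) ^ 2 / |ω| := by
    refine div_le_div_of_nonneg_right ?_ hω0.le
    have h3 : (PI + L * PI') * Real.exp 1 ≤ (PI + 829440 / (θ₁ ^ 2 * ω ^ 2 * M) * PI') * Real.exp 1 :=
      mul_le_mul_of_nonneg_right (by nlinarith only [hLup, hPI'0]) (Real.exp_pos 1).le
    exact pow_le_pow_left₀ (by positivity) h3 2
  -- third summand
  have h3 : 1 / (2 * k₀) ≤ Real.sqrt A₀ / 2 := by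
    have e : 1 / (2 * k₀) = 1 / k₀ / 2 := by field_simp
    rw [e]; linarith only [hk₀inv]
  linarith only [h1, h2, h3]

end ThresholdRegime

end Kerr

end Literature.Geometry.Lorentzian

end
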